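import Summits.KontsevichZagierPeriods.KontsevichZagierPeriods.Theorems.RootDecompRelativeModAbsoluteRegFoldingDegOneP12

/-!
# `RegFoldingDegOne` (route `RootDecompRelativeModAbsolute`, support item stmt-KontsevichZagierPeriods-30571) — PROVED · part 13/14

Cell `decomp-kz`, lens 3 (decomp-kz-lens-3 g9): `regFoldingDegOne_holds :
Theses.RootDecompRelativeModAbsolute.RegFoldingDegOne` BY NAME (in part 14/14) — every Kontsevich–Zagier
integral representation on `ℝ²` whose integrand is a quotient `p/q` of `ℚ`-polynomials with `deg_t q ≤ 1`,
`q ≠ 0` on the domain, is equivalent in `KZ.relations` to `[g] + Σᵢ [Uᵢ]`, the `Uᵢ` honest 2-cells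
`[g.domain × (0,1), hᵢ(x) θ^{Mᵢ}/(1 + θ^{eᵢ} κᵢ(x))]` (unfolded REGULARISED log/arctan monomials), with the
fibre integrals matching a.e.  Architecture: §1–§2 regularised terms `RTerm`, `RegFolding d`; §7 a.e.-congruence;
§8 gluing (`FoldsTo`); §9 one-band toolkit; §P analytic core (kernel independence); §10 cylinders; §11 affine band
chart; §13 `RegFolding 1` from a CAD band cover a.e. + vanishing on unbounded bands; last part: the edge to the born
item text and `regFoldingDegOne_holds`.

Source: `HOME/decomp-kz-lens-3/g9/landing/RootDecompRelativeModAbsoluteRegFoldingDegOne.lean` sha256 60038aa44a5f6303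
(4275 l; critic decomp-kz-crit-1 g2 CLEARED/kernel-confirmed 2026-08-30T09:41:19Z, std axioms), split mechanically
into 14 modules ≤ 400 lines by the landing seat decomp-kz-census-1 g7 (contexts re-opened per part; generic docstrings
added where the source had none; parts 1–13 do not import the route file).  No `sorry`; standard axioms.
References: [cite: KontsevichZagier2001, §1.2]; Basu–Pollack–Roy 2006 Def. 5.1 / Cor. 5.7; Bochnak–Coste–Roy 1998 §2.9.
-/

noncomputable section

open Set MeasureTheory Filter Topology
open scoped BigOperators
open Literature.NumberTheory.Transcendental Literature.ModelTheory.ExponentialFields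

namespace Summit.KontsevichZagierPeriods.RootDecompRelativeModAbsolute.Rung30571

namespace RegularisedLogLayer

section Extraction

variable {m : ℕ}

/-- **Expansion in the last variable**: `P(z) = Σ_{i ≤ d} lastCoeffᵢ(P)(init z) · (z last)^i`
for any `d ≥ deg_{last} P`. [elementary algebra] -/
theorem aeval_eq_sum_lastCoeff (P : MvPolynomial (Fin (m + 1)) ℚ) {d : ℕ}
    (hd : P.degreeOf (Fin.last m) ≤ d) (z : Fin (m + 1) → ℝ) :
    MvPolynomial.aeval z P =
      ∑ i ∈ Finset.range (d + 1), lastCoeff P i (Fin.init z) * z (Fin.last m) ^ i := by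
  classical
  have hR : ∑ i ∈ Finset.range (d + 1), lastCoeff P i (Fin.init z) * z (Fin.last m) ^ i =
      ∑ s ∈ P.support, ((MvPolynomial.coeff s P : ℚ) : ℝ) *
        (∏ j : Fin m, Fin.init z j ^ s (Fin.castSucc j)) * z (Fin.last m) ^ s (Fin.last m) := by
    simp only [lastCoeff, Finset.sum_mul]
    rw [Finset.sum_comm]
    refine Finset.sum_congr rfl fun s hs => ?_
    rw [Finset.sum_eq_single (s (Fin.last m))]
    · rw [if_pos rfl]
    · intro i _ hi
      rw [if_neg (Ne.symm hi), zero_mul]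
    · intro hnot
      exfalso
      exact hnot (Finset.mem_range.2 (Nat.lt_succ_of_le
        ((MvPolynomial.monomial_le_degreeOf (Fin.last m) hs).trans hd)))
  rw [hR]
  conv_lhs => rw [MvPolynomial.as_sum P]
  rw [map_sum]
  refine Finset.sum_congr rfl fun s _ => ?_
  rw [MvPolynomial.aeval_monomial, Finsupp.prod_fintype _ _ (fun j => pow_zero (z j)),
    Fin.prod_univ_castSucc, eq_ratCast]
  simp only [Fin.init]
  ring

/-- **The §11 data of a `t`-degree-`≤ 1` rational integrand** (`IsRationalDegLE 1 r`):
coefficient functions `pᵢ, q₀, q₁`, `ℚ`-semialgebraic on every `ℚ`-semialgebraic base set, with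
`r.integrand = (Σ pᵢ(x)tⁱ)/(q₀(x) + q₁(x)t)` and `q₀ + q₁t ≠ 0` on `r.domain`. -/
theorem exists_lastCoeff_form {r : KZ.IntegralRep (1 + 1)} (h : IsRationalDegLE 1 r) :
    ∃ (n : ℕ) (p : ℕ → (Fin 1 → ℝ) → ℝ) (q₀ q₁ : (Fin 1 → ℝ) → ℝ),
      (∀ i, ∀ S : Set (Fin 1 → ℝ), IsSemialgebraic ℚ S → IsSemialgebraicFunOn ℚ S (p i)) ∧
      (∀ S : Set (Fin 1 → ℝ), IsSemialgebraic ℚ S → IsSemialgebraicFunOn ℚ S q₀) ∧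
      (∀ S : Set (Fin 1 → ℝ), IsSemialgebraic ℚ S → IsSemialgebraicFunOn ℚ S q₁) ∧
      (∀ z ∈ r.domain, q₀ (Fin.init z) + q₁ (Fin.init z) * z (Fin.last 1) ≠ 0) ∧
      EqOn r.integrand (fun z =>
        (∑ i ∈ Finset.range (n + 1), p i (Fin.init z) * z (Fin.last 1) ^ i) /
          (q₀ (Fin.init z) + q₁ (Fin.init z) * z (Fin.last 1))) r.domain := by
  obtain ⟨P, Q, hQd, hQne, hPQ⟩ := h
  have hQ : ∀ z : Fin (1 + 1) → ℝ, MvPolynomial.aeval z Q =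
      lastCoeff Q 0 (Fin.init z) + lastCoeff Q 1 (Fin.init z) * z (Fin.last 1) := fun z => by
    rw [aeval_eq_sum_lastCoeff Q hQd z]
    simp [Finset.sum_range_succ]
  refine ⟨P.degreeOf (Fin.last 1), lastCoeff P, lastCoeff Q 0, lastCoeff Q 1,
    fun i S hS => isSemialgebraicFunOn_lastCoeff hS P i,
    fun S hS => isSemialgebraicFunOn_lastCoeff hS Q 0,
    fun S hS => isSemialgebraicFunOn_lastCoeff hS Q 1, fun z hz => ?_, fun z hz => ?_⟩
  · rw [← hQ z]
    exact hQne z hz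
  · rw [hPQ hz]
    simp only [hQ z, aeval_eq_sum_lastCoeff P le_rfl z]

end Extraction

/-! ### §13.2 The two pieces and the glue -/

section Pieces

variable {b : ℕ}

/-- **Regular sections over an open base**: `G` open `ℚ`-semialgebraic, sections
`ξ₀ < ⋯ < ξ_{l-1}` `ℚ`-semialgebraic and differentiable on `G`. -/
structure RegularSections (G : Set (Fin b → ℝ)) {l : ℕ} (ξ : Fin l → (Fin b → ℝ) → ℝ) : Prop where
  isOpen : IsOpen G
  isSemialgebraic : IsSemialgebraic ℚ G
  sa : ∀ i, IsSemialgebraicFunOn ℚ G (ξ i)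
  diff : ∀ i, DifferentiableOn ℝ (ξ i) G
  strictMono : ∀ x ∈ G, StrictMono fun i => ξ i x

/-- A CAD band over a `ℚ`-semialgebraic base with `ℚ`-semialgebraic sections is
`ℚ`-semialgebraic (= `isSemialgebraic_bandOver'` of `SemialgebraicDimension.lean`, whose import
chain is not available here; same proof). [BPR 2006, Def. 5.1] -/
theorem isSemialgebraic_bandOver_of_sa {l : ℕ} {S : Set (Fin b → ℝ)} (hS : IsSemialgebraic ℚ S)
    {ξ : Fin l → (Fin b → ℝ) → ℝ} (hξ : ∀ i, IsSemialgebraicFunOn ℚ S (ξ i)) (j : Fin (l + 1)) :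
    IsSemialgebraic ℚ (bandOver S ξ j) := by
  have hV : IsSemialgebraic ℚ {z : Fin (b + 1) → ℝ | Fin.init z ∈ S} := hS.setOf_init_mem
  have hlow : IsSemialgebraic ℚ {z : Fin (b + 1) → ℝ | Fin.init z ∈ S ∧
      bandLower ξ j (Fin.init z) < (z (Fin.last b) : EReal)} := by
    by_cases h0 : j = 0
    · subst h0
      convert hV using 1
      ext z
      simp
    · have h := (hξ (j.pred h0)).isSemialgebraic_setOf_le tarski_seidenberg_real_holds
      convert hV.diff h using 1
      ext z
      simp only [mem_setOf_eq, Set.mem_sdiff, bandLower_of_ne_zero ξ j h0, EReal.coe_lt_coe_iff]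
      constructor
      · rintro ⟨hz, hlt⟩
        exact ⟨hz, fun h' => absurd h'.2 (not_le.mpr hlt)⟩
      · rintro ⟨hz, hn⟩
        exact ⟨hz, not_le.mp fun hle => hn ⟨hz, hle⟩⟩
  have hup : IsSemialgebraic ℚ {z : Fin (b + 1) → ℝ | Fin.init z ∈ S ∧
      (z (Fin.last b) : EReal) < bandUpper ξ j (Fin.init z)} := by
    by_cases hl : j = Fin.last l
    · subst hl
      convert hV using 1
      ext z
      simp
    · have h := (hξ (j.castPred hl)).isSemialgebraic_setOf_ge tarski_seidenberg_real_holds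
      convert hV.diff h using 1
      ext z
      simp only [mem_setOf_eq, Set.mem_sdiff, bandUpper_of_ne_last ξ j hl, EReal.coe_lt_coe_iff]
      constructor
      · rintro ⟨hz, hlt⟩
        exact ⟨hz, fun h' => absurd h'.2 (not_le.mpr hlt)⟩
      · rintro ⟨hz, hn⟩
        exact ⟨hz, not_le.mp fun hle => hn ⟨hz, hle⟩⟩
  have hset : bandOver S ξ j = {z : Fin (b + 1) → ℝ | Fin.init z ∈ S ∧
      bandLower ξ j (Fin.init z) < (z (Fin.last b) : EReal)} ∩
      {z | Fin.init z ∈ S ∧ (z (Fin.last b) : EReal) < bandUpper ξ j (Fin.init z)} := by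
    ext z
    simp only [mem_bandOver_iff, mem_inter_iff, mem_setOf_eq]
    tauto
  rw [hset]
  exact hlow.inter hup

/-- **Piece 1 — BAND COVER a.e.** Every `ℚ`-semialgebraic `D ⊆ ℝᵇ⁺¹` is, up to a null set, a
finite a.e.-disjoint union of CAD bands `bandOver G ξ j ⊆ D` over OPEN `ℚ`-semialgebraic bases
with `ℚ`-semialgebraic DIFFERENTIABLE strictly ordered sections (`j = 0` / `j = l`: unbounded
below / above). [BPR 2006 Cor. 5.7 (tree: `IsSemialgebraic.exists_cylindricalDecomposition_holds`)
+ BCR 1998 §2.9 (tree: `KZ.exists_isOpen_contDiffOn`); KNOWN — proved for `b = 1` in §13.4] -/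
def BandCoverAE (b : ℕ) : Prop :=
  ∀ D : Set (Fin (b + 1) → ℝ), IsSemialgebraic ℚ D →
    ∃ (N : ℕ) (G : Fin N → Set (Fin b → ℝ)) (l : Fin N → ℕ)
      (ξ : (k : Fin N) → Fin (l k) → (Fin b → ℝ) → ℝ) (j : (k : Fin N) → Fin (l k + 1)),
      (∀ k, RegularSections (G k) (ξ k)) ∧
      (∀ k, bandOver (G k) (ξ k) (j k) ⊆ D) ∧
      (∀ k k', k ≠ k' → volume (bandOver (G k) (ξ k) (j k) ∩ bandOver (G k') (ξ k') (j k')) = 0) ∧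
      volume (D \ ⋃ k, bandOver (G k) (ξ k) (j k)) = 0

/-- **Piece 2 — VANISHING ON UNBOUNDED BANDS.** A representation on a `t`-unbounded CAD band
(`j = 0` or `j = l`) whose integrand is `(Σ_{i≤n} pᵢ(x)tⁱ)/(q₀(x) + q₁(x)t)` with non-vanishing
denominator has a.e.-zero integrand: a non-zero rational function with denominator of degree `≤ 1`
is not integrable at `±∞`. [elementary; proved in §13.3] -/
def UnboundedBandVanish (b : ℕ) : Prop :=
  ∀ (r : KZ.IntegralRep (b + 1)) (G : Set (Fin b → ℝ)) (l : ℕ) (ξ : Fin l → (Fin b → ℝ) → ℝ)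
    (j : Fin (l + 1)), RegularSections G ξ → (j = 0 ∨ j = Fin.last l) →
    r.domain = bandOver G ξ j →
    ∀ (n : ℕ) (p : ℕ → (Fin b → ℝ) → ℝ) (q₀ q₁ : (Fin b → ℝ) → ℝ),
      (∀ z ∈ r.domain, q₀ (Fin.init z) + q₁ (Fin.init z) * z (Fin.last b) ≠ 0) →
      EqOn r.integrand (fun z =>
        (∑ i ∈ Finset.range (n + 1), p i (Fin.init z) * z (Fin.last b) ^ i) /
          (q₀ (Fin.init z) + q₁ (Fin.init z) * z (Fin.last b))) r.domain →
      ∀ᵐ z, z ∈ r.domain → r.integrand z = 0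

/-- **GLUE (PROVED): `RegFolding 1` from the two pieces.** Cover `r.domain` a.e. by regular CAD
bands (piece 1); a bounded band (`0 < j < l`) is the open band `{ξ_{j-1} < t < ξ_j}` over an open
base with differentiable edges and folds by the affine chart (`foldsTo_band_ratDegOne`, §11, fed by
`exists_lastCoeff_form`); an unbounded band carries an a.e.-zero integrand (piece 2) and folds to
the empty term; `foldsTo_of_cover` (§4) glues. -/
theorem regFolding_one_of_pieces (hC : BandCoverAE 1) (hV : UnboundedBandVanish 1) :
    RegFolding 1 := by
  rw [regFolding_iff_foldsTo]
  intro r hr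
  obtain ⟨n, p, q₀, q₁, hp, hq₀, hq₁, hqne, hint⟩ := exists_lastCoeff_form hr
  obtain ⟨N, G, l, ξ, j, hreg, hsub, hdisj, hcov⟩ := hC r.domain r.isSemialgebraic_domain
  have hsa : ∀ k, IsSemialgebraic ℚ (bandOver (G k) (ξ k) (j k)) := fun k =>
    isSemialgebraic_bandOver_of_sa (hreg k).isSemialgebraic (hreg k).sa (j k)
  refine foldsTo_of_cover (fun k => bandOver (G k) (ξ k) (j k)) hsa hsub hdisj hcov fun k => ?_
  set rk := r.restrict (bandOver (G k) (ξ k) (j k)) (hsa k) (hsub k) with hrk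
  have hdomk : rk.domain = bandOver (G k) (ξ k) (j k) := rfl
  have hintk : EqOn rk.integrand (fun z =>
      (∑ i ∈ Finset.range (n + 1), p i (Fin.init z) * z (Fin.last 1) ^ i) /
        (q₀ (Fin.init z) + q₁ (Fin.init z) * z (Fin.last 1))) rk.domain :=
    fun z hz => hint (hsub k hz)
  have hqnek : ∀ z ∈ rk.domain, q₀ (Fin.init z) + q₁ (Fin.init z) * z (Fin.last 1) ≠ 0 :=
    fun z hz => hqne z (hsub k hz)
  by_cases hjb : j k = 0 ∨ j k = Fin.last (l k)
  · -- unbounded band: the integrand vanishes a.e.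
    have hae := hV rk (G k) (l k) (ξ k) (j k) (hreg k) hjb rfl n p q₀ q₁ hqnek hintk
    let r₀ : KZ.IntegralRep (1 + 1) := ⟨rk.domain, 0, rk.isSemialgebraic_domain,
      (isSemialgebraicFunOn_ratCast rk.isSemialgebraic_domain 0).congr fun z _ => by simp,
      integrableOn_zero⟩
    exact ⟨_, _, FoldsTo.of_ae_eq (r' := r₀) rfl (hae.mono fun z hz hzd => hz hzd)
      (foldsTo_empty_of_integrand_zero (r := r₀) fun z _ => rfl)⟩
  · -- bounded band: the affine chart
    push Not at hjb
    obtain ⟨h0, hl⟩ := hjb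
    have hband : rk.domain = {z : Fin (1 + 1) → ℝ | (Fin.init z : Fin 1 → ℝ) ∈ G k ∧
        ξ k ((j k).pred h0) (Fin.init z) < z (Fin.last 1) ∧
          z (Fin.last 1) < ξ k ((j k).castPred hl) (Fin.init z)} := by
      rw [hdomk]
      ext z
      simp only [mem_bandOver_iff, bandLower_of_ne_zero (ξ k) (j k) h0,
        bandUpper_of_ne_last (ξ k) (j k) hl, EReal.coe_lt_coe_iff, mem_setOf_eq]
    have hlt : ∀ x ∈ G k, ξ k ((j k).pred h0) x < ξ k ((j k).castPred hl) x := by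
      intro x hx
      refine (hreg k).strictMono x hx (Fin.lt_def.2 ?_)
      rw [Fin.val_pred, Fin.coe_castPred]
      have := Fin.pos_iff_ne_zero.2 h0
      omega
    exact foldsTo_band_ratDegOne rk (hreg k).isOpen (hreg k).isSemialgebraic
      ((hreg k).sa _) ((hreg k).sa _) ((hreg k).diff _) ((hreg k).diff _) hlt hband n
      (fun i => hp i _ (hreg k).isSemialgebraic) (hq₀ _ (hreg k).isSemialgebraic)
      (hq₁ _ (hreg k).isSemialgebraic)
      (fun x hx t h1 h2 => by
        have hmem : (Fin.snoc x t : Fin (1 + 1) → ℝ) ∈ rk.domain := by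
          rw [hband, mem_setOf_eq, Fin.init_snoc, Fin.snoc_last]
          exact ⟨hx, h1, h2⟩
        have := hqnek _ hmem
        rwa [Fin.init_snoc, Fin.snoc_last] at this)
      hintk

end Pieces

/-! ### §13.3 Piece 2 PROVED: vanishing on unbounded bands -/

section Vanish

variable {b : ℕ}

/-- **A non-zero rational function with denominator of degree `≤ 1` is not integrable at `+∞`.**
If `P(t)/(A + Bt)` (denominator non-vanishing on the ray) is integrable on `(c, ∞)` then `P = 0`:
`|P(t)| ≳ t^{deg P}` (`Polynomial.isEquivalent_atTop_lead`), `|A + Bt| ≲ t`, so the quotient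
dominates `κ/t ∉ L¹` (`not_integrableOn_Ioi_inv`). [elementary] -/
theorem poly_eq_zero_of_integrableOn_Ioi (P : Polynomial ℝ) (A B c : ℝ)
    (hne : ∀ t, c < t → A + B * t ≠ 0)
    (hint : IntegrableOn (fun t => P.eval t / (A + B * t)) (Ioi c)) : P = 0 := by
  by_contra hP
  have hlc : P.leadingCoeff ≠ 0 := Polynomial.leadingCoeff_ne_zero.2 hP
  have hAB : 0 < |A| + |B| := by
    rcases eq_or_ne B 0 with hB | hB
    · have hA : A ≠ 0 := by
        have := hne (c + 1) (by linarith)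
        rw [hB] at this
        simpa using this
      exact add_pos_of_pos_of_nonneg (abs_pos.2 hA) (abs_nonneg B)
    · exact add_pos_of_nonneg_of_pos (abs_nonneg A) (abs_pos.2 hB)
  obtain ⟨C, hCpos, hC⟩ := (Polynomial.isEquivalent_atTop_lead P).isBigO_symm.exists_pos
  obtain ⟨T₀, hT₀⟩ := Filter.eventually_atTop.1 hC.bound
  set T : ℝ := max (max T₀ c) 1 with hT
  have hTc : c ≤ T := (le_max_right _ _).trans (le_max_left _ _)
  have hT1 : (1 : ℝ) ≤ T := le_max_right _ _
  have hTT₀ : T₀ ≤ T := (le_max_left _ _).trans (le_max_left _ _)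
  set κ : ℝ := |P.leadingCoeff| / (C * (|A| + |B|)) with hκ
  have hκpos : 0 < κ := div_pos (abs_pos.2 hlc) (mul_pos hCpos hAB)
  -- the lower bound `κ/t ≤ |P(t)/(A+Bt)|` on `(T, ∞)`
  have hlow : ∀ t, T < t → κ * t⁻¹ ≤ |P.eval t / (A + B * t)| := by
    intro t ht
    have ht1 : 1 ≤ t := hT1.trans ht.le
    have htpos : 0 < t := by linarith
    have h1 : |P.leadingCoeff| * t ^ P.natDegree ≤ C * |P.eval t| := by
      have := hT₀ t (hTT₀.trans ht.le)
      simpa [Real.norm_eq_abs, abs_mul, abs_pow, abs_of_pos htpos] using this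
    have h2 : |A + B * t| ≤ (|A| + |B|) * t := by
      calc |A + B * t| ≤ |A| + |B * t| := abs_add_le _ _
        _ = |A| + |B| * t := by rw [abs_mul, abs_of_pos htpos]
        _ ≤ |A| * t + |B| * t := by nlinarith [abs_nonneg A]
        _ = (|A| + |B|) * t := by ring
    have h3 : 0 < |A + B * t| := abs_pos.2 (hne t (lt_of_le_of_lt hTc ht))
    rw [abs_div, le_div_iff₀ h3]
    have hCne : C ≠ 0 := hCpos.ne'
    have hABne : |A| + |B| ≠ 0 := hAB.ne'
    have htne : t ≠ 0 := htpos.ne'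
    calc κ * t⁻¹ * |A + B * t| ≤ κ * t⁻¹ * ((|A| + |B|) * t) :=
          mul_le_mul_of_nonneg_left h2 (mul_pos hκpos (inv_pos.2 htpos)).le
      _ = |P.leadingCoeff| / C := by
          rw [hκ]
          field_simp
      _ ≤ |P.leadingCoeff| * t ^ P.natDegree / C := by
          gcongr
          exact le_mul_of_one_le_right (abs_nonneg _) (one_le_pow₀ ht1)
      _ ≤ |P.eval t| := by
          rw [div_le_iff₀ hCpos]
          linarith [h1]
  -- hence `κ/t`, and so `1/t`, would be integrable on `(T, ∞)`
  have hgi : IntegrableOn (fun t : ℝ => κ * t⁻¹) (Ioi T) := by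
    refine Integrable.mono (hint.mono_set (Ioi_subset_Ioi hTc))
      (measurable_inv.const_mul κ).aestronglyMeasurable ?_
    refine (ae_restrict_iff' measurableSet_Ioi).2 (ae_of_all _ fun t ht => ?_)
    rw [Real.norm_eq_abs, Real.norm_eq_abs, abs_of_pos (mul_pos hκpos (inv_pos.2 (by
      have : (1 : ℝ) ≤ T := hT1; exact lt_of_lt_of_le (by linarith) ht.le)))]
    exact hlow t ht
  have hinv : IntegrableOn (fun t : ℝ => t⁻¹) (Ioi T) := by
    have h2 : IntegrableOn (fun t : ℝ => κ⁻¹ * (κ * t⁻¹)) (Ioi T) := hgi.const_mul κ⁻¹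
    refine h2.congr_fun (fun t _ => ?_) measurableSet_Ioi
    show κ⁻¹ * (κ * t⁻¹) = t⁻¹
    rw [← mul_assoc, inv_mul_cancel₀ hκpos.ne', one_mul]
  exact not_integrableOn_Ioi_inv hinv

/-- The same at `-∞` (reflect `t ↦ -t`). [elementary] -/
theorem poly_eq_zero_of_integrableOn_Iio (P : Polynomial ℝ) (A B c : ℝ)
    (hne : ∀ t, t < c → A + B * t ≠ 0)
    (hint : IntegrableOn (fun t => P.eval t / (A + B * t)) (Iio c)) : P = 0 := by
  have h := poly_eq_zero_of_integrableOn_Ioi (P.comp (-Polynomial.X)) A (-B) (-c)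
    (fun s hs => by
      have := hne (-s) (by linarith)
      convert this using 1
      ring) ?_
  · apply Polynomial.funext
    intro t
    have := congrArg (Polynomial.eval (-t)) h
    simpa [Polynomial.eval_comp] using this
  · rw [← (Measure.measurePreserving_neg (volume : Measure ℝ)).integrableOn_comp_preimage
      (Homeomorph.neg ℝ).measurableEmbedding] at hint
    simp only [Function.comp_def, neg_preimage, neg_Iio] at hint
    refine hint.congr_fun (fun s _ => ?_) measurableSet_Ioi
    simp only [Polynomial.eval_comp, Polynomial.eval_neg, Polynomial.eval_X]
    ring

/-- `bandLower_ne_top`: auxiliary theorem of the `RegFoldingDegOne` (stmt-30571) development — see the module docstring; statement and proof verbatim from the lens-3 g9 landing file. -/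
theorem bandLower_ne_top {l : ℕ} (ξ : Fin l → (Fin b → ℝ) → ℝ) (j : Fin (l + 1)) (x : Fin b → ℝ) :
    bandLower ξ j x ≠ ⊤ := by
  unfold bandLower
  induction j using Fin.cases <;> simp

/-- `bandUpper_ne_bot`: auxiliary theorem of the `RegFoldingDegOne` (stmt-30571) development — see the module docstring; statement and proof verbatim from the lens-3 g9 landing file. -/
theorem bandUpper_ne_bot {l : ℕ} (ξ : Fin l → (Fin b → ℝ) → ℝ) (j : Fin (l + 1)) (x : Fin b → ℝ) :
    bandUpper ξ j x ≠ ⊥ := by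
  unfold bandUpper
  induction j using Fin.lastCases <;> simp

end Vanish

end RegularisedLogLayer

end Summit.KontsevichZagierPeriods.RootDecompRelativeModAbsolute.Rung30571

end
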